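import Literature.InformationTheory.QuantumCodes.QuantumExpanderNoisySyndromeLemma26
import HarnessLib

/-!
# Small-set-flip with a NOISY syndrome (Fawzi–Grospellier–Leverrier, FOCS 2018), part 8: the probability that a FIXED set is a
# witness (first display of the proof of Thm. 13) — PROOF

Index of sources: `[cite: FawziGrospellierLeverrier2018FT]` = Fawzi–Grospellier–Leverrier, FOCS 2018 / arXiv:1808.03821, proof of Thm. 13
(p0021 L26-40: "for a fixed `W ⊆ V`, `W` is a witness for `(S,D)` implies that there is a set `T ⊆ Γ_X(W)` such that `|W| ≤ c₀|T|` and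
`T ⊆ D`. Thus … `ℙ[W is a witness] ≤ Σ_{T ⊆ Γ_X(W), |W| ≤ c₀|T|} p_synd^{|T|}` … Since the cardinality of `Γ_X(W)` is upper bounded by
`d_B|W|` …"); `[cite: Gottesman2014]` §2 (local stochastic noise; tree `IsLocallyStochastic`).

Topic `Literature/InformationTheory/QuantumCodes` (venture QEC, row 04 `prover-qec-type-04` gen 8, line L-SSF-NOISY = PARTITION v2.48 D50.L8,
node N16). GENERIC over a finite check set with a locally stochastic law `μ` of parameter `q ∈ [0,1]` (the tree's `IsLocallyStochastic`,
`ClusterCountingBound.lean`): for a fixed neighbourhood `N` and a threshold `w ≤ c₀|D ∩ N|`, the `μ`-weight of the syndrome errors `D`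
meeting it is at most `2^{|N|}·q^{⌈w/c₀⌉}` (union bound over the `T ⊆ N` with `c₀|T| ≥ w`; the paper sharpens `2^{|N|}` by the binary-entropy
bound on binomials, which only changes the constant `K` of Thm. 13). With `|Γ_X(W)| ≤ max Δ·|W|` (`card_checkNbhd_le`) this is
`ℙ[W is a c₀-witness] ≤ (2^{max Δ})^{|W|}·q^{⌈|W|/c₀⌉}` for the quantum expander code.

* `sum_filter_superset_biUnion_le` — union bound helper;
* ★ `sum_filter_witness_le` — `Σ_{D : w ≤ c₀|D ∩ N|} μ(D) ≤ 2^{|N|} q^{⌈w/c₀⌉₊}` (generic);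
* `sum_filter_isWitness_le` — the quantum expander instance with `N = Γ_X(W)`, `w = |W|`: `≤ 2^{max Δ·|W|} q^{⌈|W|/c₀⌉₊}`;
* `isLocallyStochastic_marginal_inr` / `_inl` — the syndrome / qubit marginals of a locally stochastic law on `V ⊔ C_X` (Def. 9 in the tree's
  one-parameter vocabulary on the sum type) are locally stochastic with the same parameter (so the bounds above apply to the joint law).

Column word: PROVED (kernel); no definitions, no named facts. (The remaining step of Thm. 13 — summing over the witnesses `W ∈ 𝓜(S)`,
Gottesman 2014 Lemma 2 — is NOT here.)
-/

namespace Literature.InformationTheory.QuantumCodes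

open Finset Matrix Literature.Probability.LatticeModels

namespace SmallSetFlip

/-- Union bound: the weight of a union is at most the sum of the weights (nonnegative weights). [folklore] -/
private theorem sum_biUnion_le_sum' {α β : Type*} [DecidableEq β] (T : Finset α) (B : α → Finset β) (W : β → ℝ)
    (hW : ∀ b, 0 ≤ W b) : ∑ b ∈ T.biUnion B, W b ≤ ∑ a ∈ T, ∑ b ∈ B a, W b := by
  classical
  induction T using Finset.induction_on with
  | empty => simp
  | insert a T ha ih =>
    rw [Finset.biUnion_insert, Finset.sum_insert ha]
    have hu : ∑ b ∈ B a ∪ T.biUnion B, W b ≤ ∑ b ∈ B a, W b + ∑ b ∈ T.biUnion B, W b := by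
      rw [← Finset.sum_union_inter]
      have : 0 ≤ ∑ b ∈ B a ∩ T.biUnion B, W b := Finset.sum_nonneg fun b _ => hW b
      linarith
    linarith

/-- ★ **`ℙ[w ≤ c₀·|D ∩ N|] ≤ 2^{|N|}·q^{⌈w/c₀⌉}` for a locally stochastic syndrome error `D`** (parameter `q ∈ [0,1]`): the event forces
some `T ⊆ N` with `T ⊆ D` and `c₀|T| ≥ w` (take `T = D ∩ N`), each of probability `≤ q^{|T|} ≤ q^{⌈w/c₀⌉}`, and there are at most `2^{|N|}`
of them. [cite: FawziGrospellierLeverrier2018FT, proof of Thm 13, first display (arXiv p0021 L26-33)] [cite: Gottesman2014, §2 (local stochastic)] -/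
theorem sum_filter_witness_le {C : Type*} [Fintype C] [DecidableEq C] {μ : Finset C → ℝ} {q : ℝ}
    (hμ : IsLocallyStochastic μ q) (hq0 : 0 ≤ q) (hq1 : q ≤ 1) (N : Finset C) {c₀ w : ℝ} (hc₀ : 0 < c₀) :
    ∑ D ∈ univ.filter (fun D : Finset C => w ≤ c₀ * ((D ∩ N).card : ℝ)), μ D
      ≤ (2 : ℝ) ^ N.card * q ^ ⌈w / c₀⌉₊ := by
  classical
  set good : Finset (Finset C) := N.powerset.filter fun T => w ≤ c₀ * (T.card : ℝ) with hgood
  have hcover : univ.filter (fun D : Finset C => w ≤ c₀ * ((D ∩ N).card : ℝ))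
      ⊆ good.biUnion fun T => univ.filter fun D => T ⊆ D := by
    intro D hD
    rw [Finset.mem_filter] at hD
    rw [Finset.mem_biUnion]
    refine ⟨D ∩ N, ?_, ?_⟩
    · rw [hgood, Finset.mem_filter, Finset.mem_powerset]
      exact ⟨Finset.inter_subset_right, hD.2⟩
    · rw [Finset.mem_filter]
      exact ⟨Finset.mem_univ _, Finset.inter_subset_left⟩
  have hstep1 : ∑ D ∈ univ.filter (fun D : Finset C => w ≤ c₀ * ((D ∩ N).card : ℝ)), μ D
      ≤ ∑ T ∈ good, ∑ D ∈ univ.filter (fun D => T ⊆ D), μ D :=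
    (Finset.sum_le_sum_of_subset_of_nonneg hcover fun D _ _ => hμ.nonneg D).trans
      (sum_biUnion_le_sum' good _ μ hμ.nonneg)
  have hstep2 : ∀ T ∈ good, ∑ D ∈ univ.filter (fun D => T ⊆ D), μ D ≤ q ^ ⌈w / c₀⌉₊ := by
    intro T hT
    rw [hgood, Finset.mem_filter, Finset.mem_powerset] at hT
    refine (hμ.sum_filter_superset_le T).trans ?_
    -- `⌈w/c₀⌉ ≤ |T|` since `w/c₀ ≤ |T|`
    have hT' : w / c₀ ≤ (T.card : ℝ) := by
      rw [div_le_iff₀ hc₀]; linarith [hT.2]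
    have hceil : ⌈w / c₀⌉₊ ≤ T.card := Nat.ceil_le.2 hT'
    exact pow_le_pow_of_le_one hq0 hq1 hceil
  have hstep3 : ∑ T ∈ good, ∑ D ∈ univ.filter (fun D => T ⊆ D), μ D ≤ (good.card : ℝ) * q ^ ⌈w / c₀⌉₊ := by
    have := Finset.sum_le_sum hstep2
    refine this.trans ?_
    rw [Finset.sum_const, nsmul_eq_mul]
  have hgood_card : (good.card : ℝ) ≤ (2 : ℝ) ^ N.card := by
    have h1 : good.card ≤ N.powerset.card := Finset.card_filter_le _ _
    rw [Finset.card_powerset] at h1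
    exact_mod_cast h1
  calc ∑ D ∈ univ.filter (fun D : Finset C => w ≤ c₀ * ((D ∩ N).card : ℝ)), μ D
      ≤ (good.card : ℝ) * q ^ ⌈w / c₀⌉₊ := hstep1.trans hstep3
    _ ≤ (2 : ℝ) ^ N.card * q ^ ⌈w / c₀⌉₊ :=
        mul_le_mul_of_nonneg_right hgood_card (pow_nonneg hq0 _)

/-- **Marginals of a locally stochastic law on `V ⊔ C_X` are locally stochastic** (check side): if the joint error `X = E ⊔ D ⊆ V ⊔ C_X`
follows a locally stochastic law of parameter `p` (FGL18b Def. 9 with `p = max(p_phys, p_synd)`, in the tree's one-parameter vocabulary on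
the sum type), then so does its syndrome part `D = {c : inr c ∈ X}`: `Σ_{X : T ⊆ D(X)} μ X = Σ_{X ⊇ T.map inr} μ X ≤ p^{|T|}`.
[cite: FawziGrospellierLeverrier2018FT, Def 9 (local stochastic (E, D); arXiv p0011 L20-27)] [cite: Gottesman2014, §2] -/
theorem isLocallyStochastic_marginal_inr {Q C : Type*} [Fintype Q] [Fintype C] [DecidableEq Q] [DecidableEq C]
    {μ : Finset (Q ⊕ C) → ℝ} {p : ℝ} (hμ : IsLocallyStochastic μ p) :
    IsLocallyStochastic
      (fun D : Finset C => ∑ X ∈ univ.filter (fun X : Finset (Q ⊕ C) => (univ.filter fun c => Sum.inr c ∈ X) = D), μ X) p := by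
  classical
  refine ⟨fun D => Finset.sum_nonneg fun X _ => hμ.nonneg X, fun T => ?_⟩
  -- regroup the double sum as one sum over `X` with `T ⊆ D(X)`
  have hfib : ∑ D ∈ univ.filter (fun D : Finset C => T ⊆ D),
      ∑ X ∈ univ.filter (fun X : Finset (Q ⊕ C) => (univ.filter fun c => Sum.inr c ∈ X) = D), μ X
      = ∑ X ∈ univ.filter (fun X : Finset (Q ⊕ C) => T ⊆ univ.filter fun c => Sum.inr c ∈ X), μ X := by
    rw [← Finset.sum_fiberwise_of_maps_to (s := univ.filter (fun X : Finset (Q ⊕ C) => T ⊆ univ.filter fun c => Sum.inr c ∈ X))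
      (t := univ.filter (fun D : Finset C => T ⊆ D)) (g := fun X : Finset (Q ⊕ C) => univ.filter fun c => Sum.inr c ∈ X)
      (f := μ) ?_]
    · refine Finset.sum_congr rfl fun D hD => ?_
      refine Finset.sum_congr ?_ fun _ _ => rfl
      ext X
      simp only [Finset.mem_filter, Finset.mem_univ, true_and]
      constructor
      · intro h
        refine ⟨?_, h⟩
        rw [h]; exact (Finset.mem_filter.1 hD).2
      · rintro ⟨-, h⟩; exact h
    · intro X hX
      rw [Finset.mem_filter] at hX ⊢
      exact ⟨Finset.mem_univ _, hX.2⟩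
  rw [hfib]
  -- `T ⊆ D(X)` iff `T.map inr ⊆ X`
  have hset : univ.filter (fun X : Finset (Q ⊕ C) => T ⊆ univ.filter fun c => Sum.inr c ∈ X)
      = univ.filter (fun X : Finset (Q ⊕ C) => T.map Function.Embedding.inr ⊆ X) := by
    ext X
    simp only [Finset.mem_filter, Finset.mem_univ, true_and, Finset.subset_iff, Finset.mem_map,
      Function.Embedding.inr_apply]
    constructor
    · rintro h y ⟨c, hc, rfl⟩; exact h hc
    · intro h c hc; exact h ⟨c, hc, rfl⟩
  rw [hset]
  have h := hμ.sum_filter_superset_le (T.map Function.Embedding.inr)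
  rwa [Finset.card_map] at h

/-- The qubit-side marginal, symmetrically: `E = {q : inl q ∈ X}` is locally stochastic with the same parameter.
[cite: FawziGrospellierLeverrier2018FT, Def 9 (arXiv p0011 L20-27)] -/
theorem isLocallyStochastic_marginal_inl {Q C : Type*} [Fintype Q] [Fintype C] [DecidableEq Q] [DecidableEq C]
    {μ : Finset (Q ⊕ C) → ℝ} {p : ℝ} (hμ : IsLocallyStochastic μ p) :
    IsLocallyStochastic
      (fun E : Finset Q => ∑ X ∈ univ.filter (fun X : Finset (Q ⊕ C) => (univ.filter fun q => Sum.inl q ∈ X) = E), μ X) p := by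
  classical
  refine ⟨fun E => Finset.sum_nonneg fun X _ => hμ.nonneg X, fun T => ?_⟩
  have hfib : ∑ E ∈ univ.filter (fun E : Finset Q => T ⊆ E),
      ∑ X ∈ univ.filter (fun X : Finset (Q ⊕ C) => (univ.filter fun q => Sum.inl q ∈ X) = E), μ X
      = ∑ X ∈ univ.filter (fun X : Finset (Q ⊕ C) => T ⊆ univ.filter fun q => Sum.inl q ∈ X), μ X := by
    rw [← Finset.sum_fiberwise_of_maps_to (s := univ.filter (fun X : Finset (Q ⊕ C) => T ⊆ univ.filter fun q => Sum.inl q ∈ X))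
      (t := univ.filter (fun E : Finset Q => T ⊆ E)) (g := fun X : Finset (Q ⊕ C) => univ.filter fun q => Sum.inl q ∈ X)
      (f := μ) ?_]
    · refine Finset.sum_congr rfl fun E hE => ?_
      refine Finset.sum_congr ?_ fun _ _ => rfl
      ext X
      simp only [Finset.mem_filter, Finset.mem_univ, true_and]
      constructor
      · intro h
        refine ⟨?_, h⟩
        rw [h]; exact (Finset.mem_filter.1 hE).2
      · rintro ⟨-, h⟩; exact h
    · intro X hX
      rw [Finset.mem_filter] at hX ⊢
      exact ⟨Finset.mem_univ _, hX.2⟩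
  rw [hfib]
  have hset : univ.filter (fun X : Finset (Q ⊕ C) => T ⊆ univ.filter fun q => Sum.inl q ∈ X)
      = univ.filter (fun X : Finset (Q ⊕ C) => T.map Function.Embedding.inl ⊆ X) := by
    ext X
    simp only [Finset.mem_filter, Finset.mem_univ, true_and, Finset.subset_iff, Finset.mem_map,
      Function.Embedding.inl_apply]
    constructor
    · rintro h y ⟨q, hq, rfl⟩; exact h hq
    · intro h q hq; exact h ⟨q, hq, rfl⟩
  rw [hset]
  have h := hμ.sum_filter_superset_le (T.map Function.Embedding.inl)
  rwa [Finset.card_map] at h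

end SmallSetFlip

namespace QuantumExpander

variable {A B : Type*} [Fintype A] [Fintype B] [DecidableEq A] [DecidableEq B]

/-- **`ℙ[W is a c₀-witness for (S, D)] ≤ 2^{max Δ·|W|}·q^{⌈|W|/c₀⌉}`** for the quantum expander code `Q_G` and a locally stochastic
syndrome error `D` of parameter `q`: the witness inequality `|W| ≤ c₀|D ∩ Γ_X(W)|` with `|Γ_X(W)| ≤ max Δ·|W|` (`card_checkNbhd_le`).
(Printed: `≤ Σ_{|T| ≥ |W|/c₀} C(d_B|W|, |T|) p_synd^{|T|} ≤ p₁^{|W|}/(1 − p₁^{c₀})` with the entropy bound; here the cruder `2^{max Δ|W|}`.)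
[cite: FawziGrospellierLeverrier2018FT, proof of Thm 13 (arXiv p0021 L26-40)] -/
theorem sum_filter_isWitness_le (H : Matrix B A (ZMod 2)) {dA dB : ℕ} (hreg : IsBiregular H dA dB)
    {μ : Finset (A × B) → ℝ} {q : ℝ} (hμ : IsLocallyStochastic μ q) (hq0 : 0 ≤ q) (hq1 : q ≤ 1)
    (W : Finset ((A × A) ⊕ (B × B))) {c₀ : ℝ} (hc₀ : 0 < c₀) :
    ∑ D ∈ univ.filter (fun D : Finset (A × B) =>
        (W.card : ℝ) ≤ c₀ * ((D ∩ univ.filter fun c => ∃ q ∈ W, expanderHX H c q ≠ 0).card : ℝ)), μ D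
      ≤ (2 : ℝ) ^ (max dA dB * W.card) * q ^ ⌈(W.card : ℝ) / c₀⌉₊ := by
  classical
  have h := SmallSetFlip.sum_filter_witness_le hμ hq0 hq1 (univ.filter fun c => ∃ q ∈ W, expanderHX H c q ≠ 0)
    (w := (W.card : ℝ)) hc₀
  refine h.trans (mul_le_mul_of_nonneg_right ?_ (pow_nonneg hq0 _))
  exact pow_le_pow_right₀ (by norm_num) (card_checkNbhd_le H hreg W)

end QuantumExpander

end Literature.InformationTheory.QuantumCodes
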